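import Mathlib
import Literature.NumberTheory.LFunctions.Zhang2022.Section15ResidueMainTerms
import Literature.NumberTheory.LFunctions.Zhang2022.TypedSection15C
import Literature.NumberTheory.LFunctions.Zhang2022.TypedSection16B
import HarnessLib

/-!
# Zhang (2022) §15 p. 88 / §16 p. 95, "direct calculation" of the residue products — III: the edges

Topic `Literature/NumberTheory/LFunctions/Zhang2022` (Landau–Siegel audit tree; verdict-neutral).
Y. Zhang, *Discrete mean estimates and the Landau–Siegel zero*, arXiv:2211.02515v1 (2022)
[Zhang2022LandauSiegel] — **an unrefereed manuscript under adjudication** (cell siegel-zhang, D-0069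
width campaign). DISCHARGE file (theorems only; no new definitions, no new facts); no statement about
Theorems 1–2 of the manuscript or about Landau–Siegel zeros is made or implied.

Kernel-checked deduction EDGES between typed CLAIM nodes of `Typed.Section15C` (L4-t3, p412250) and
`Typed.Section16B` (L4-t5):
* `step15_u060_of`, `step15_u061_of`, `step15_u062_of` — DAG `Z22:§15.u060`, `u061`, `u062`
  [Z22 p.88, tex L4385–L4392]: "Hence, by direct calculation, `ℛ₁*ℛ₁₁ = 1 + O(1/𝓛)`,
  `ℛ₁*ℛ₁₂ = 2 + O(1/𝓛)`, `ℛ₁*ℛ₁₃ = 1 + O(1/𝓛)`" FROM `Z22:§15.u058` (`ℛ₁* = β₁β₂L′(1,χ) + O(𝓛⁻²⁴)`)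
  and `Z22:§15.u059` (`ℛ₁ⱼ = P₄^{β₃−βⱼ}/((β_{j+1}−βⱼ)(β_{j+2}−βⱼ)L′(1,χ)) + O(𝓛⁻³)`), for EVERY
  instantiation `X : Inputs15AB` of the §15A/B objects (so they compose with whichever merge of
  slices 15A/15B the lead adopts). The common core `product_core` and the main terms are in `Section15ResidueMainTerms`.
* `step16_u044_of` — DAG `Z22:§16.u044` [Z22 p.95, tex L4678–L4681]: "so that
  `ℛ₂*ℛ₂ⱼ = −1/L′(1,χ) + O(𝓛⁻¹L′(1,χ)⁻¹)`" FROM `Z22:§16.u043` (`ℛ₂* = β₁ + O(𝓛⁻¹⁰)`,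
  `ℛ₂ⱼ = −1/(β₁L′(1,χ)) + O(𝓛⁶)`), over the concrete `Section16A.calR2star`, `Section16A.calR2` (t5's `Step16_u043`/`Step16_u044`, revision of 00:10Z).

What is NOT here: the values `ℛ₁*, ℛ₁ⱼ, ℛ₂*, ℛ₂ⱼ` themselves (nodes u058/u059/u043: Lemma 5.8,
Lemma 5.4 (ii), residues of `ζ`), and anything downstream ((15.24) = `Skeleton.Eval1524`,
(16.17) = `Skeleton.Eval1617`, held by other seats).
-/

noncomputable section

open Complex Real Filter Topology

namespace Literature.NumberTheory.LFunctions.Zhang2022.ResidueValues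

open Skeleton

/-! ## The edges `u058 ∧ u059 ⟹ u060, u061, u062` (Z22:§15.u060–u062, p. 88) -/

section Edges

open Typed.Section15C

variable (c' : ℝ) (X : Typed.Section15C.Inputs15AB)

/-- **Z22:§15.u060 from u058 and u059** (§15 p. 88, tex L4385: "Hence, by direct calculation,
`ℛ₁*ℛ₁₁ = 1 + O(1/𝓛)`"), for every instantiation `X` of the §15A/B objects. Kernel-checked: the
main terms multiply to `β₁β₂P₄^{β₃−β₁}/((β₂−β₁)(β₃−β₁)) = 1 + O(1/𝓛)` (`mainTerm_one`), and the
cross terms are `O(𝓛⁻⁶)` by `|L′(1,χ)| ≫ 1` (Lemma 5.7) and `|L′(1,χ)| ≪ 𝓛²`.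
[cite: Zhang2022LandauSiegel, §15 p. 88] -/
theorem step15_u060_of (h58 : Step15_u058 c' X) (h59 : Step15_u059 c' X) : Step15_u060 c' X := by
  obtain ⟨C₁, h58'⟩ := h58
  obtain ⟨C₂, h59'⟩ := h59
  obtain ⟨c, hc, h57⟩ := norm_deriv_LFunction_one_ge
  obtain ⟨D₀, hall⟩ := (h58'.and h59').and h57
  refine ⟨(max C₁ 0 * max C₂ 0 + 4 * max C₁ 0 / (π ^ 2 * c) + 64 * Real.exp (9 / 2) * π ^ 2 * max C₂ 0) +
      (24 * |c'| * π + 1042 * π + 1400 * (|c'| * π)),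
    max D₀ (max ⌈Real.exp 3⌉₊ ⌈Real.exp (14 * |c'| * π)⌉₊), fun D _ χ hD hq hp hA => ?_⟩
  have hD₀ : D₀ ≤ D := le_trans (le_max_left _ _) hD
  obtain ⟨hL, he⟩ := thresholds c' (le_trans (le_max_right _ _) hD)
  have hℓ : 0 < ell D := by linarith
  obtain ⟨⟨g58, g59⟩, g57⟩ := hall D χ hD₀ hq hp
  have e58 : ‖X.calR1star c' χ - beta1 c' D * beta2 c' D * deriv χ.LFunction 1‖ ≤
      max C₁ 0 / ell D ^ 24 :=
    (g58 hA).trans (by gcongr; exact le_max_left _ _)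
  have e59 := (g59 hA 1 (by simp)).trans
    (show C₂ / ell D ^ 3 ≤ max C₂ 0 / ell D ^ 3 by gcongr; exact le_max_left _ _)
  have hk : betaJ c' D (1 + 1) - betaJ c' D 1 =
      I * ((alpha D * (1 + 7 * (c' * alpha D * ell D)) : ℝ) : ℂ) := by
    show betaJ c' D 2 - betaJ c' D 1 = _
    rw [betaJ_two, betaJ_one, beta1_eq, beta2_eq]; push_cast; ring
  have hk' : betaJ c' D (1 + 2) - betaJ c' D 1 =
      I * ((alpha D * (2 + 2 * (c' * alpha D * ell D)) : ℝ) : ℂ) := by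
    show betaJ c' D 3 - betaJ c' D 1 = _
    rw [betaJ_three, betaJ_one, beta1_eq, beta3_eq]; push_cast; ring
  have he' := abs_le.mp he
  have hr₁ : 1 / 2 ≤ |1 + 7 * (c' * alpha D * ell D)| := by rw [le_abs]; left; linarith
  have hr₂ : 1 / 2 ≤ |2 + 2 * (c' * alpha D * ell D)| := by rw [le_abs]; left; linarith
  have hδ : ‖beta1 c' D * beta2 c' D * ((P4 D : ℝ) : ℂ) ^ (beta3 c' D - betaJ c' D 1) /
      ((betaJ c' D (1 + 1) - betaJ c' D 1) * (betaJ c' D (1 + 2) - betaJ c' D 1)) - 1‖ ≤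
      24 * |c' * alpha D * ell D| + 2 * |alpha D * Real.log (P4 D) - π| +
        2 * |c' * alpha D * ell D| * |alpha D * Real.log (P4 D)| := by
    show ‖beta1 c' D * beta2 c' D * ((P4 D : ℝ) : ℂ) ^ (beta3 c' D - betaJ c' D 1) /
      ((betaJ c' D 2 - betaJ c' D 1) * (betaJ c' D 3 - betaJ c' D 1)) - 1‖ ≤ _
    rw [betaJ_one, betaJ_two, betaJ_three]
    exact mainTerm_one c' hL he
  have hcore := product_core c' χ hL he hp hk hr₁ hk' hr₂ (le_max_right C₁ 0) (le_max_right C₂ 0)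
    hc (g57 hA) e58 e59 (v := 1) hδ
  have hmain := mainErr_le c' hL 24 2 2 (by norm_num) (by norm_num) (by norm_num)
  calc ‖X.calR1star c' χ * X.calR1 c' χ 1 - 1‖ ≤ _ := hcore
    _ ≤ (max C₁ 0 * max C₂ 0 + 4 * max C₁ 0 / (π ^ 2 * c) + 64 * Real.exp (9 / 2) * π ^ 2 * max C₂ 0) /
          ell D + (24 * |c'| * π + 1042 * π + 1400 * (|c'| * π)) / ell D := by
        have : (24 * |c'| * π + 2 * 521 * π + 2 * 700 * (|c'| * π)) / ell D =
            (24 * |c'| * π + 1042 * π + 1400 * (|c'| * π)) / ell D := by norm_num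
        linarith
    _ = _ := (add_div _ _ _).symm

/-- **Z22:§15.u061 from u058 and u059** (§15 p. 88, tex L4388: "`ℛ₁*ℛ₁₂ = 2 + O(1/𝓛)`"), for every
instantiation `X` of the §15A/B objects; main term `β₁β₂P₄^{β₃−β₂}/((β₃−β₂)(β₁−β₂)) = 2 + O(1/𝓛)`
(`mainTerm_two`). [cite: Zhang2022LandauSiegel, §15 p. 88] -/
theorem step15_u061_of (h58 : Step15_u058 c' X) (h59 : Step15_u059 c' X) : Step15_u061 c' X := by
  obtain ⟨C₁, h58'⟩ := h58
  obtain ⟨C₂, h59'⟩ := h59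
  obtain ⟨c, hc, h57⟩ := norm_deriv_LFunction_one_ge
  obtain ⟨D₀, hall⟩ := (h58'.and h59').and h57
  refine ⟨(max C₁ 0 * max C₂ 0 + 4 * max C₁ 0 / (π ^ 2 * c) + 64 * Real.exp (9 / 2) * π ^ 2 * max C₂ 0) +
      (24 * |c'| * π + 1042 * π + 7000 * (|c'| * π)),
    max D₀ (max ⌈Real.exp 3⌉₊ ⌈Real.exp (14 * |c'| * π)⌉₊), fun D _ χ hD hq hp hA => ?_⟩
  have hD₀ : D₀ ≤ D := le_trans (le_max_left _ _) hD
  obtain ⟨hL, he⟩ := thresholds c' (le_trans (le_max_right _ _) hD)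
  have hℓ : 0 < ell D := by linarith
  obtain ⟨⟨g58, g59⟩, g57⟩ := hall D χ hD₀ hq hp
  have e58 : ‖X.calR1star c' χ - beta1 c' D * beta2 c' D * deriv χ.LFunction 1‖ ≤
      max C₁ 0 / ell D ^ 24 :=
    (g58 hA).trans (by gcongr; exact le_max_left _ _)
  have e59 := (g59 hA 2 (by simp)).trans
    (show C₂ / ell D ^ 3 ≤ max C₂ 0 / ell D ^ 3 by gcongr; exact le_max_left _ _)
  have hk : betaJ c' D (2 + 1) - betaJ c' D 2 =
      I * ((alpha D * (1 - 5 * (c' * alpha D * ell D)) : ℝ) : ℂ) := by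
    show betaJ c' D 3 - betaJ c' D 2 = _
    rw [betaJ_two, betaJ_three, beta2_eq, beta3_eq]; push_cast; ring
  have hk' : betaJ c' D (2 + 2) - betaJ c' D 2 =
      I * ((alpha D * (-1 - 7 * (c' * alpha D * ell D)) : ℝ) : ℂ) := by
    show betaJ c' D 4 - betaJ c' D 2 = _
    rw [betaJ_four, betaJ_two, beta1_eq, beta2_eq]; push_cast; ring
  have he' := abs_le.mp he
  have hr₁ : 1 / 2 ≤ |1 - 5 * (c' * alpha D * ell D)| := by rw [le_abs]; left; linarith
  have hr₂ : 1 / 2 ≤ |-1 - 7 * (c' * alpha D * ell D)| := by rw [le_abs]; right; linarith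
  have hδ : ‖beta1 c' D * beta2 c' D * ((P4 D : ℝ) : ℂ) ^ (beta3 c' D - betaJ c' D 2) /
      ((betaJ c' D (2 + 1) - betaJ c' D 2) * (betaJ c' D (2 + 2) - betaJ c' D 2)) - 2‖ ≤
      24 * |c' * alpha D * ell D| + 2 * |alpha D * Real.log (P4 D) - π| +
        10 * |c' * alpha D * ell D| * |alpha D * Real.log (P4 D)| := by
    show ‖beta1 c' D * beta2 c' D * ((P4 D : ℝ) : ℂ) ^ (beta3 c' D - betaJ c' D 2) /
      ((betaJ c' D 3 - betaJ c' D 2) * (betaJ c' D 4 - betaJ c' D 2)) - 2‖ ≤ _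
    rw [betaJ_two, betaJ_three, betaJ_four]
    exact mainTerm_two c' hL he
  have hcore := product_core c' χ hL he hp hk hr₁ hk' hr₂ (le_max_right C₁ 0) (le_max_right C₂ 0)
    hc (g57 hA) e58 e59 (v := 2) hδ
  have hmain := mainErr_le c' hL 24 2 10 (by norm_num) (by norm_num) (by norm_num)
  calc ‖X.calR1star c' χ * X.calR1 c' χ 2 - 2‖ ≤ _ := hcore
    _ ≤ (max C₁ 0 * max C₂ 0 + 4 * max C₁ 0 / (π ^ 2 * c) + 64 * Real.exp (9 / 2) * π ^ 2 * max C₂ 0) /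
          ell D + (24 * |c'| * π + 1042 * π + 7000 * (|c'| * π)) / ell D := by
        have : (24 * |c'| * π + 2 * 521 * π + 10 * 700 * (|c'| * π)) / ell D =
            (24 * |c'| * π + 1042 * π + 7000 * (|c'| * π)) / ell D := by norm_num
        linarith
    _ = _ := (add_div _ _ _).symm

/-- **Z22:§15.u062 from u058 and u059** (§15 p. 88, tex L4391: "`ℛ₁*ℛ₁₃ = 1 + O(1/𝓛)`"), for every
instantiation `X` of the §15A/B objects; here the main term is EXACTLY `1`
(`β₁β₂/((β₁−β₃)(β₂−β₃)) = 1`, `P₄⁰ = 1`: `mainTerm_three`), so only the cross terms contribute.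
[cite: Zhang2022LandauSiegel, §15 p. 88] -/
theorem step15_u062_of (h58 : Step15_u058 c' X) (h59 : Step15_u059 c' X) : Step15_u062 c' X := by
  obtain ⟨C₁, h58'⟩ := h58
  obtain ⟨C₂, h59'⟩ := h59
  obtain ⟨c, hc, h57⟩ := norm_deriv_LFunction_one_ge
  obtain ⟨D₀, hall⟩ := (h58'.and h59').and h57
  refine ⟨max C₁ 0 * max C₂ 0 + 4 * max C₁ 0 / (π ^ 2 * c) + 64 * Real.exp (9 / 2) * π ^ 2 * max C₂ 0,
    max D₀ (max ⌈Real.exp 3⌉₊ ⌈Real.exp (14 * |c'| * π)⌉₊), fun D _ χ hD hq hp hA => ?_⟩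
  have hD₀ : D₀ ≤ D := le_trans (le_max_left _ _) hD
  obtain ⟨hL, he⟩ := thresholds c' (le_trans (le_max_right _ _) hD)
  have hℓ : 0 < ell D := by linarith
  obtain ⟨⟨g58, g59⟩, g57⟩ := hall D χ hD₀ hq hp
  have e58 : ‖X.calR1star c' χ - beta1 c' D * beta2 c' D * deriv χ.LFunction 1‖ ≤
      max C₁ 0 / ell D ^ 24 :=
    (g58 hA).trans (by gcongr; exact le_max_left _ _)
  have e59 := (g59 hA 3 (by simp)).trans
    (show C₂ / ell D ^ 3 ≤ max C₂ 0 / ell D ^ 3 by gcongr; exact le_max_left _ _)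
  have hk : betaJ c' D (3 + 1) - betaJ c' D 3 =
      I * ((alpha D * (-2 - 2 * (c' * alpha D * ell D)) : ℝ) : ℂ) := by
    show betaJ c' D 4 - betaJ c' D 3 = _
    rw [betaJ_four, betaJ_three, beta1_eq, beta3_eq]; push_cast; ring
  have hk' : betaJ c' D (3 + 2) - betaJ c' D 3 =
      I * ((alpha D * (-1 + 5 * (c' * alpha D * ell D)) : ℝ) : ℂ) := by
    show betaJ c' D 5 - betaJ c' D 3 = _
    rw [betaJ_five, betaJ_three, beta2_eq, beta3_eq]; push_cast; ring
  have he' := abs_le.mp he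
  have hr₁ : 1 / 2 ≤ |-2 - 2 * (c' * alpha D * ell D)| := by rw [le_abs]; right; linarith
  have hr₂ : 1 / 2 ≤ |-1 + 5 * (c' * alpha D * ell D)| := by rw [le_abs]; right; linarith
  have hδ : ‖beta1 c' D * beta2 c' D * ((P4 D : ℝ) : ℂ) ^ (beta3 c' D - betaJ c' D 3) /
      ((betaJ c' D (3 + 1) - betaJ c' D 3) * (betaJ c' D (3 + 2) - betaJ c' D 3)) - 1‖ ≤ 0 := by
    show ‖beta1 c' D * beta2 c' D * ((P4 D : ℝ) : ℂ) ^ (beta3 c' D - betaJ c' D 3) /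
      ((betaJ c' D 4 - betaJ c' D 3) * (betaJ c' D 5 - betaJ c' D 3)) - 1‖ ≤ 0
    rw [betaJ_three, betaJ_four, betaJ_five, mainTerm_three c' (alpha_pos hL) he, sub_self, norm_zero]
  have hcore := product_core c' χ hL he hp hk hr₁ hk' hr₂ (le_max_right C₁ 0) (le_max_right C₂ 0)
    hc (g57 hA) e58 e59 (v := 1) hδ
  rw [add_zero] at hcore
  exact hcore

end Edges

/-! ## The edge `u043 ⟹ u044` (Z22:§16.u044, p. 95) -/

section EdgeSixteen

open Typed.Section16A Typed.Section16B

variable (c' : ℝ)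

/-- **Z22:§16.u044 from u043** (§16 p. 95, tex L4678–L4681: "so that
`ℛ₂*ℛ₂ⱼ = −1/L′(1,χ) + O(𝓛⁻¹L′(1,χ)⁻¹)`", `j = 1, 2`). Kernel-checked: with `ℛ₂* = β₁ + E₁`,
`ℛ₂ⱼ = −1/(β₁L′) + E₂`, `|E₁| ≤ C𝓛⁻¹⁰`, `|E₂| ≤ C𝓛⁶` one has
`ℛ₂*ℛ₂ⱼ + 1/L′ = β₁E₂ − E₁/(β₁L′) + E₁E₂`, and `|β₁| ≍ α = π𝓛⁻⁹`, `|L′(1,χ)| ≤ 2e^{9/2}(1+𝓛)𝓛`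
(tree `Lemma31.norm_deriv_LFunction_le_near_one`) make each term `≪ 1/(𝓛|L′(1,χ)|)`.
[cite: Zhang2022LandauSiegel, §16 p. 95] -/
theorem step16_u044_of (h43 : Step16_u043 c') : Step16_u044 c' := by
  obtain ⟨C, h43'⟩ := h43
  obtain ⟨c, hc, h57⟩ := norm_deriv_LFunction_one_ge
  obtain ⟨D₀, hall⟩ := h43'.and h57
  refine ⟨8 * π * Real.exp (9 / 2) * max C 0 + 2 * max C 0 / π + 4 * Real.exp (9 / 2) * max C 0 ^ 2,
    max D₀ (max ⌈Real.exp 3⌉₊ ⌈Real.exp (14 * |c'| * π)⌉₊), fun D _ χ hD hq hp hA => ?_⟩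
  have hD₀ : D₀ ≤ D := le_trans (le_max_left _ _) hD
  obtain ⟨hL, he⟩ := thresholds c' (le_trans (le_max_right _ _) hD)
  have hℓ : 0 < ell D := by linarith
  have hℓ1 : 1 ≤ ell D := by linarith
  have hα := alpha_pos hL
  have hαeq := Section2.alpha_eq_pi_div_ell9 D
  have hαℓ : alpha D * ell D ^ 9 = π := by
    rw [hαeq]; field_simp
  obtain ⟨g, g57⟩ := hall D χ hD₀ hq hp
  obtain ⟨g1, g2⟩ := g hA
  have hcL := g57 hA
  intro j hj
  have g2j := g2 j hj
  have hC' : 0 ≤ max C 0 := le_max_right _ _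
  have hCC' : C ≤ max C 0 := le_max_left _ _
  set L1 : ℂ := deriv χ.LFunction 1 with hL1
  have hN : 0 < ‖L1‖ := lt_of_lt_of_le hc hcL
  have hL0 : L1 ≠ 0 := fun h => by rw [h, norm_zero] at hN; exact lt_irrefl _ hN
  set E₁ : ℂ := calR2star c' χ - beta1 c' D with hE₁
  set E₂ : ℂ := calR2 c' χ j + 1 / (beta1 c' D * L1) with hE₂
  have hE₁b : ‖E₁‖ ≤ max C 0 / ell D ^ 10 := by
    rw [div_eq_mul_inv]; exact g1.trans (by gcongr)
  have hE₂b : ‖E₂‖ ≤ max C 0 * ell D ^ 6 := g2j.trans (by gcongr)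
  -- sizes of `β₁` and `L′(1,χ)`
  have hβu : ‖beta1 c' D‖ ≤ 2 * alpha D := norm_beta1_le c' hL he
  have he' := abs_le.mp he
  have hβl : alpha D / 2 ≤ ‖beta1 c' D‖ := by
    rw [beta1_eq]
    exact norm_I_mul_ofReal_ge hα (by rw [le_abs]; left; linarith)
  have hβne : beta1 c' D ≠ 0 := by
    intro h; rw [h, norm_zero] at hβl; linarith
  have hLu : ‖L1‖ ≤ 4 * Real.exp (9 / 2) * ell D ^ 2 := by
    refine (norm_deriv_LFunction_one_le χ hL hp).trans ?_
    have h2 : (1 + ell D) * ell D ≤ 2 * ell D ^ 2 := by nlinarith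
    have h3 := mul_le_mul_of_nonneg_left h2 (by positivity : (0 : ℝ) ≤ 2 * Real.exp (9 / 2))
    calc 2 * Real.exp (9 / 2) * (1 + ell D) * ell D = 2 * Real.exp (9 / 2) * ((1 + ell D) * ell D) := by
          ring
      _ ≤ 2 * Real.exp (9 / 2) * (2 * ell D ^ 2) := h3
      _ = 4 * Real.exp (9 / 2) * ell D ^ 2 := by ring
  -- the algebra: `ℛ₂*ℛ₂ⱼ + 1/L′ = β₁E₂ − E₁/(β₁L′) + E₁E₂`
  have hprod : calR2star c' χ * calR2 c' χ j + 1 / L1 =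
      beta1 c' D * E₂ - E₁ / (beta1 c' D * L1) + E₁ * E₂ := by
    have e1 : calR2star c' χ = beta1 c' D + E₁ := by rw [hE₁]; ring
    have e2 : calR2 c' χ j = -(1 / (beta1 c' D * L1)) + E₂ := by rw [hE₂]; ring
    rw [e1, e2]
    field_simp
    ring
  rw [hprod]
  -- the three terms, each `≤ (its constant)/(𝓛‖L′‖)`
  have hpos : 0 < ell D * ‖L1‖ := mul_pos hℓ hN
  have t1 : ‖beta1 c' D * E₂‖ * (ell D * ‖L1‖) ≤ 8 * π * Real.exp (9 / 2) * max C 0 := by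
    rw [norm_mul]
    have h1 : ‖beta1 c' D‖ * ‖E₂‖ ≤ 2 * alpha D * (max C 0 * ell D ^ 6) :=
      mul_le_mul hβu hE₂b (norm_nonneg _) (by positivity)
    calc ‖beta1 c' D‖ * ‖E₂‖ * (ell D * ‖L1‖)
        ≤ 2 * alpha D * (max C 0 * ell D ^ 6) * (ell D * (4 * Real.exp (9 / 2) * ell D ^ 2)) := by
          gcongr
      _ = 8 * Real.exp (9 / 2) * max C 0 * (alpha D * ell D ^ 9) := by ring
      _ = 8 * π * Real.exp (9 / 2) * max C 0 := by rw [hαℓ]; ring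
  have t2 : ‖E₁ / (beta1 c' D * L1)‖ * (ell D * ‖L1‖) ≤ 2 * max C 0 / π := by
    rw [norm_div, norm_mul]
    have hβN : 0 < ‖beta1 c' D‖ * ‖L1‖ := mul_pos (lt_of_lt_of_le (by positivity) hβl) hN
    rw [div_mul_eq_mul_div, div_le_iff₀ hβN]
    calc ‖E₁‖ * (ell D * ‖L1‖) ≤ max C 0 / ell D ^ 10 * (ell D * ‖L1‖) := by gcongr
      _ = max C 0 / ell D ^ 9 * ‖L1‖ := by field_simp
      _ = 2 * max C 0 / π * (alpha D / 2) * ‖L1‖ := by rw [hαeq]; field_simp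
      _ ≤ 2 * max C 0 / π * (‖beta1 c' D‖ * ‖L1‖) := by
          rw [mul_assoc]; gcongr
  have t3 : ‖E₁ * E₂‖ * (ell D * ‖L1‖) ≤ 4 * Real.exp (9 / 2) * max C 0 ^ 2 := by
    rw [norm_mul]
    have h1 : ‖E₁‖ * ‖E₂‖ ≤ max C 0 / ell D ^ 10 * (max C 0 * ell D ^ 6) :=
      mul_le_mul hE₁b hE₂b (norm_nonneg _) (by positivity)
    calc ‖E₁‖ * ‖E₂‖ * (ell D * ‖L1‖)
        ≤ max C 0 / ell D ^ 10 * (max C 0 * ell D ^ 6) * (ell D * (4 * Real.exp (9 / 2) * ell D ^ 2)) := by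
          gcongr
      _ = 4 * Real.exp (9 / 2) * max C 0 ^ 2 / ell D := by field_simp
      _ ≤ 4 * Real.exp (9 / 2) * max C 0 ^ 2 := div_le_self (by positivity) hℓ1
  have hsum : ‖beta1 c' D * E₂ - E₁ / (beta1 c' D * L1) + E₁ * E₂‖ * (ell D * ‖L1‖) ≤
      8 * π * Real.exp (9 / 2) * max C 0 + 2 * max C 0 / π + 4 * Real.exp (9 / 2) * max C 0 ^ 2 := by
    have htri : ‖beta1 c' D * E₂ - E₁ / (beta1 c' D * L1) + E₁ * E₂‖ ≤
        ‖beta1 c' D * E₂‖ + ‖E₁ / (beta1 c' D * L1)‖ + ‖E₁ * E₂‖ := by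
      refine (norm_add_le _ _).trans ?_
      gcongr
      exact norm_sub_le _ _
    have := mul_le_mul_of_nonneg_right htri hpos.le
    nlinarith
  have hfin := (le_div_iff₀ hpos).mpr hsum
  calc _ ≤ _ := hfin
    _ = _ := by ring

end EdgeSixteen

end Literature.NumberTheory.LFunctions.Zhang2022.ResidueValues
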